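import Summits.HodgeConjecture.HodgeConjecture.Theorems.F0P5LemD14IfFrameInvariance
import Literature.NumberTheory.Automorphic.Liu2021.LemD1Item4AtV2NonsplitEpsOfSeparation
import Literature.NumberTheory.Automorphic.Liu2021.LemD1RankTwoCMSameLabelLetter
import HarnessLib

/-!
# LD letter «R₂» (★ `LemD1RankTwoCMLetters.LemD1_4SameLabelNonsplitCM₂`) AT A NON-SPLIT PLACE FROM THE SEPARATION AT THAT PLACE — the ONE road-agnostic
# consumer in the letter's own binders (every enumeration `e₁`; theorems only)

Cell `hodgecm-mathlib` (D-0151), FLOOR 0, half A line LD1 (socket `stub_S1_facts`, #73; R₂ shared with LD2's #74R), seat LD1-p01 (g2), 2026-09-02; requested by LD2-plan (g2)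
DEALS #2 («shape the consumer with a per-place input so ONE consumer serves all non-split v»).  THEOREMS ONLY (no `def`, no named fact, no instance, no `sorry`);
`--supports stmt-HodgeConjecture-24832`.  Summits-side because ★ (E) `F0P5LemD14IfFrameInvariance.areIsomorphicRep_theta_cmPackage_of_equiv` is.

THE STATEMENT **`locF_apply_eq_of_equiv_localTypes_nonsplit_of_separation`**: R₂'s binders verbatim (CM `L`, real non-zero frame `dV : Fin 2 → L`, ANY
`e₁ : Fin 2 × Fin 1 ≃ Fin n′`, conjugate-symplectic `λ`, lines `a, a′`, centre character `χ`, finite place `v` of `L⁺`), R₂'s non-vanishing hypothesis `Θ_v(λ, a′, χ) ≠ 0` and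
R₂'s isomorphism hypothesis `Θ_v(λ, a, χ) ≅ Θ_v(λ, a′, χ)` byte-for-byte (the weight-one and non-split binders of R₂ are not needed and dropped), PLUS ONE per-place input
`hsep` = the SEPARATION of the two transported rank-one theta lifts at `v`: the body of the named fact ★ `rankOne_theta_lines_disjoint` (∕ the conclusion block of ★
`rankOne_theta_lines_disjoint_of_isotropic`, p849893) instantiated at the `e′_a`-transported sections `s_{a′}, s_a := lineTransportSection … ((𝓢_{pU,•}).s v) …` of the two
CM packages at the enumeration `pU := Equiv.prodUnique (Fin 2) (Fin 1)` on the common model `LocalMp L⁺ 2 (realDiagonal dV) v`, centre presented at the line `(a′)`: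
«`a⁻¹δ ⊗ 1`, `a′⁻¹δ ⊗ 1` in different classes → `Θ_{s_{a′}}(χ_v) ≠ 0` → `Θ_{s_{a′}}(χ_v) ≅ Θ_{s_a}(χ_v)` → `False`»; conclusion R₂'s: `locF L⁺ (imagUnitSq L) a v = locF L⁺ (imagUnitSq L) a′ v`.
So R₂ at `v` = this theorem + `hsep` at `v`:
* at an ISOTROPIC `v`: `hsep := rankOne_theta_lines_disjoint_of_isotropic …` (★ p849893; cf. ★ `F0LD1SameLabelRigidityOfIsotropic`, where even `Θ ≠ 0` is not needed);
* at an ANISOTROPIC `v`: `hsep` is the matched-splitting organ of the LD2 road of record (DEALS #2: ENGINE (α*) «block-zero complementarity ⇒ separation» ∘ (P′)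
  «the inter-line dichotomy character of the same-λ CM block sections is trivial» ∘ B-p04's (R) frame junction) — no consumer is rewritten when it lands.
PROOF: `subst n′ = 2`; ★ (E) twice (`e₁ ↦ pU` on both packages); R₂'s isomorphism reversed (★ `AreIsomorphicRep.symm`) to `Θ_{pU}(a′) ≅ Θ_{pU}(a)`; R₂'s non-vanishing carried
`e₁ ↦ pU` along (E)'s linear equivalence; ★ `sameClass_and_chi_eq_of_areIsomorphicRep_localType₂_nonsplit_of_separation` (p850033, `Liu2021/LemD1Item4AtV2NonsplitEpsOfSeparation.lean`
§4′) on the family `0 ↦ a`, `1 ↦ a′` with `j := 1`, `i := 0`; ★ `locF_apply_eq_of_sameClass_epsLine`.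

HONEST LABEL.  Nothing of [Liu2021] is asserted; R₂ stays booked until `hsep` is supplied at the anisotropic places; HC_CM is proved only modulo the 7 printed citations
(2 remaining: hLiu418 = stmt-HodgeConjecture-24832, h413 = stmt-HodgeConjecture-24833) until rung 0 closes; count-neutral.

## References
* [Liu2021] Y. Liu, Camb. J. Math. 9 (2021) = arXiv:2102.11518 — App. D Lem. D.1 (4) (p. 126, TeX l. 5235) and its proof (l. 5257–5262); §D.1 Steps 1–3; Def. 4.12.
* [MoeglinVignerasWaldspurger1987] C. Mœglin, M.-F. Vignéras, J.-L. Waldspurger, LNM 1291 (1987), Chap. 2 II Remarque (3), Chap. 3 IV.4.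
* [HarrisKudlaSweet1996] M. Harris, S. Kudla, W. J. Sweet, J. AMS 9 (1996), Cor. 4.4, Thm. 6.1.
-/

set_option autoImplicit false
set_option linter.dupNamespace false

noncomputable section

open scoped Matrix Kronecker RestrictedProduct NumberField TensorProduct
open NumberField IsDedekindDomain Filter
open Literature.NumberTheory Literature.NumberTheory.Automorphic Literature.NumberTheory.Automorphic.UnitaryGroup
open Literature.NumberTheory.GelbartRogawski1991 Literature.NumberTheory.GelbartRogawski1991.UnitaryDualPair
open Literature.NumberTheory.GelbartRogawski1991.UnitaryDualPair.WeilCoinv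
open Literature.NumberTheory.GelbartRogawski1991.UnitaryDualPair.LocalSplitting
open Literature.NumberTheory.GelbartRogawski1991.GRConstruction
open Literature.NumberTheory.Weil1964 Literature.RepresentationTheory
open Literature.RepresentationTheory.HeisenbergGroup
open Literature.NumberTheory.GaloisRepresentations Literature.RepresentationTheory.HarrisKudlaSweet1996
open Literature.NumberTheory.Automorphic.IdeleClassGroup Literature.RepresentationTheory.Liu2021
open Literature.NumberTheory.Automorphic.Liu2021 Literature.NumberTheory.Automorphic.Liu2021.Def411WeilCarriers
open Literature.NumberTheory.Automorphic.Liu2021.Def411WeilCarriersDoubling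
open Literature.NumberTheory.Automorphic.Liu2021.LemD1RankTwoCMLetters
open Summit.HodgeConjecture.HodgeConjecture.Cruxes.HLiu418.F0P5LemD14IfFrameInvariance

namespace Summit.HodgeConjecture.HodgeConjecture.Cruxes.HLiu418.F0LD1SameLabelRigidityOfSeparation

set_option synthInstance.maxHeartbeats 400000 in
set_option maxHeartbeats 4000000 in -- the CM θ-package terms of the letter's binders (cf. ★ E₂ `locF_apply_eq_of_equiv_localTypes_nonsplit'`, 3.2 M)
/-- **THE LETTER «R₂» AT A NON-SPLIT PLACE FROM THE SEPARATION AT THAT PLACE** — R₂'s binders, non-vanishing and isomorphism hypotheses VERBATIM (any enumeration `e₁`),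
plus `hsep` = the body of ★ `rankOne_theta_lines_disjoint` at the two `e′_a`-transported CM sections (`pU := Equiv.prodUnique (Fin 2) (Fin 1)`, model `LocalMp L⁺ 2 (realDiagonal dV) v`,
centre at `(a′)`; orientation «`a, a′` in different local classes → `Θ_{s_{a′}} ≠ 0` → `Θ_{s_{a′}} ≅ Θ_{s_a}` → `False`»); conclusion `locF L⁺ (imagUnitSq L) a v = locF L⁺ (imagUnitSq L) a′ v`.
At an isotropic `v` take `hsep := rankOne_theta_lines_disjoint_of_isotropic …` (★); at an anisotropic `v` `hsep` is the LD2 organ.  Proof: ★ (E) twice, ★ `AreIsomorphicRep.symm`,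
non-vanishing carried along (E), ★ `sameClass_and_chi_eq_of_areIsomorphicRep_localType₂_nonsplit_of_separation` on the family `![a, a′]` (`j := 1`, `i := 0`), ★
`locF_apply_eq_of_sameClass_epsLine`. [cite: Liu2021, App. D Lemma D.1 (4) (p. 126, l. 5235), proof l. 5257–5262; Def. 4.12]
[cite: MoeglinVignerasWaldspurger1987, Chap. 3 IV.4] [cite: HarrisKudlaSweet1996, Cor. 4.4, Thm. 6.1] -/
theorem locF_apply_eq_of_equiv_localTypes_nonsplit_of_separation
    (L : Type) [Field L] [NumberField L] [IsCMField L]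
    (dV : Fin 2 → L) (hdV : ∀ i, IsCMField.complexConj L (dV i) = dV i) (hdV0 : ∀ i, dV i ≠ 0)
    {n' : ℕ} (e₁ : Fin 2 × Fin 1 ≃ Fin n')
    (lam : Literature.NumberTheory.Automorphic.IdeleClassGroup L →ₜ* Circle) (hlam : IsConjugateSymplectic L lam)
    (a a' : (↥(maximalRealSubfield L))ˣ) (χ : Chi (↥(maximalRealSubfield L)) L (IsCMField.complexConj L))
    (v : HeightOneSpectrum (𝓞 (↥(maximalRealSubfield L))))
    (hsep : (¬ ∃ x : (LocalRing L v)ˣ, LemD1OfPlace.eps L v (lineDelta_ne_zero (imagUnit_ne_zero L) a) =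
        x * Units.map (conjLocal L (IsCMField.complexConj L) v : LocalRing L v →* LocalRing L v) x * LemD1OfPlace.eps L v (lineDelta_ne_zero (imagUnit_ne_zero L) a')) →
      Nontrivial (TwistedCoinv.Coinv
        ((show Representation ℂ (localPi L (IsCMField.complexConj L) 1 (JW (Fp L) L a') v) (SchwartzBruhat (Fin 2 → v.adicCompletion (Fp L))) from
          ((MpPsi.toRep (localSchrodinger (Fp L) 2 (realDiagonal L dV hdV) v)).comp (lineTransportSection (Fp L) L (IsCMField.complexConj L) 2 (complexConj_imagUnit L) (imagUnit_ne_zero L) (imagUnit_mul_self L) (realDiagonal L dV hdV) (realDiagonal_isSymm L dV hdV) (Matrix.diagonal dV) (realDiagonal_map L dV hdV).symm a' v ((congrW L (Equiv.prodUnique (Fin 2) (Fin 1)) dV hdV (lineW L (TW (Fp L) a')) (complexConj_lineW L (TW (Fp L) a')) (realDiagonal_lineW L (TW (Fp L) a')) (diagonal_lineW L (TW (Fp L) a') (JW_eq (Fp L) L a')) (undoubledSplittings L (Equiv.prodUnique (Fin 2) (Fin 1)) dV hdV hdV0 (lineW L (TW (Fp L) a')) (complexConj_lineW L (TW (Fp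 L) a')) (lineW_ne_zero L (TW (Fp L) a') (isUnit_det_TW (Fp L) a')) (toHeckeCharacter L lam) (borelPlaceMeasure L) (cmFinLocalFamily L (Equiv.prodUnique (Fin 2) (Fin 1)) dV hdV hdV0 (lineW L (TW (Fp L) a')) (complexConj_lineW L (TW (Fp L) a')) (lineW_ne_zero L (TW (Fp L) a') (isUnit_det_TW (Fp L) a')) (toHeckeCharacter L lam) ((isOscillatorChar_toHeckeCharacter_iff lam).mpr hlam) (borelPlaceMeasure L))) (isSymm_TW (Fp L) a') (JW_eq (Fp L) L a')).s v) ((congrW L (Equiv.prodUnique (Fin 2) (Fin 1)) dV hdV (lineW L (TW (Fp L) a')) (complexConj_lineW L (TW (Fp L) a')) (realDiagonal_lineW L (TW (Fp L) a')) (diagonal_lineW L (TW (Fp L) a') (JW_eq (Fp L) L a')) (undoubledSplittings L (Equiv.prodUnique (Fin 2) (Fin 1)) dV hdV hdV0 (lineW L (TW (Fp L) a')) (complexConj_lineW L (TW (Fp L) a')) (lineW_ne_zero L (TW (Fp L) a') (isUnit_det_TW (Fp L) a')) (toHeckeCharacter L lam) (borelPlaceMeasure L) (cmFinLocalFamily L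 (Equiv.prodUnique (Fin 2) (Fin 1)) dV hdV hdV0 (lineW L (TW (Fp L) a')) (complexConj_lineW L (TW (Fp L) a')) (lineW_ne_zero L (TW (Fp L) a') (isUnit_det_TW (Fp L) a')) (toHeckeCharacter L lam) ((isOscillatorChar_toHeckeCharacter_iff lam).mpr hlam) (borelPlaceMeasure L))) (isSymm_TW (Fp L) a') (JW_eq (Fp L) L a')).proj_s v))).comp (localCenter L (IsCMField.complexConj L) 2 (Matrix.diagonal dV) (JW (Fp L) L a') (JW_apply_ne_zero (Fp L) L a') v)))
        (localCharOfCenter (Fp L) L (IsCMField.complexConj L) (JW (Fp L) L a') (JW_apply_ne_zero (Fp L) L a') χ.1 v)) →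
      AreIsomorphicRep
        (TwistedCoinv.rep
          (ρW := show Representation ℂ (localPi L (IsCMField.complexConj L) 1 (JW (Fp L) L a') v) (SchwartzBruhat (Fin 2 → v.adicCompletion (Fp L))) from
            ((MpPsi.toRep (localSchrodinger (Fp L) 2 (realDiagonal L dV hdV) v)).comp (lineTransportSection (Fp L) L (IsCMField.complexConj L) 2 (complexConj_imagUnit L) (imagUnit_ne_zero L) (imagUnit_mul_self L) (realDiagonal L dV hdV) (realDiagonal_isSymm L dV hdV) (Matrix.diagonal dV) (realDiagonal_map L dV hdV).symm a' v ((congrW L (Equiv.prodUnique (Fin 2) (Fin 1)) dV hdV (lineW L (TW (Fp L) a')) (complexConj_lineW L (TW (Fp L) a')) (realDiagonal_lineW L (TW (Fp L) a')) (diagonal_lineW L (TW (Fp L) a') (JW_eq (Fp L) L a')) (undoubledSplittings L (Equiv.prodUnique (Fin 2) (Fin 1)) dV hdV hdV0 (lineW L (TW (Fp L) a')) (complexConj_lineW L (TW (Fp L) a')) (lineW_ne_zero L (TW (Fp L) a') (isUnit_det_TW (Fp L) a')) (toHeckeCharacter L lam) (borelPlaceMeasure L) (cmFinLocalFamily L (Equiv.prodUnique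 (Fin 2) (Fin 1)) dV hdV hdV0 (lineW L (TW (Fp L) a')) (complexConj_lineW L (TW (Fp L) a')) (lineW_ne_zero L (TW (Fp L) a') (isUnit_det_TW (Fp L) a')) (toHeckeCharacter L lam) ((isOscillatorChar_toHeckeCharacter_iff lam).mpr hlam) (borelPlaceMeasure L))) (isSymm_TW (Fp L) a') (JW_eq (Fp L) L a')).s v) ((congrW L (Equiv.prodUnique (Fin 2) (Fin 1)) dV hdV (lineW L (TW (Fp L) a')) (complexConj_lineW L (TW (Fp L) a')) (realDiagonal_lineW L (TW (Fp L) a')) (diagonal_lineW L (TW (Fp L) a') (JW_eq (Fp L) L a')) (undoubledSplittings L (Equiv.prodUnique (Fin 2) (Fin 1)) dV hdV hdV0 (lineW L (TW (Fp L) a')) (complexConj_lineW L (TW (Fp L) a')) (lineW_ne_zero L (TW (Fp L) a') (isUnit_det_TW (Fp L) a')) (toHeckeCharacter L lam) (borelPlaceMeasure L) (cmFinLocalFamily L (Equiv.prodUnique (Fin 2) (Fin 1)) dV hdV hdV0 (lineW L (TW (Fp L) a')) (complexConj_lineW L (TW (Fp L) a')) (lineW_ne_zero L (TW (Fp L) a')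 (isUnit_det_TW (Fp L) a')) (toHeckeCharacter L lam) ((isOscillatorChar_toHeckeCharacter_iff lam).mpr hlam) (borelPlaceMeasure L))) (isSymm_TW (Fp L) a') (JW_eq (Fp L) L a')).proj_s v))).comp (localCenter L (IsCMField.complexConj L) 2 (Matrix.diagonal dV) (JW (Fp L) L a') (JW_apply_ne_zero (Fp L) L a') v))
          (localCharOfCenter (Fp L) L (IsCMField.complexConj L) (JW (Fp L) L a') (JW_apply_ne_zero (Fp L) L a') χ.1 v)
          ((MpPsi.toRep (localSchrodinger (Fp L) 2 (realDiagonal L dV hdV) v)).comp (lineTransportSection (Fp L) L (IsCMField.complexConj L) 2 (complexConj_imagUnit L) (imagUnit_ne_zero L) (imagUnit_mul_self L) (realDiagonal L dV hdV) (realDiagonal_isSymm L dV hdV) (Matrix.diagonal dV) (realDiagonal_map L dV hdV).symm a' v ((congrW L (Equiv.prodUnique (Fin 2) (Fin 1)) dV hdV (lineW L (TW (Fp L) a')) (complexConj_lineW L (TW (Fp L) a')) (realDiagonal_lineW L (TW (Fp L) a')) (diagonal_lineW L (TW (Fp L) a') (JW_eq (Fp L) L a')) (undoubledSplittings L (Equiv.prodUnique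 (Fin 2) (Fin 1)) dV hdV hdV0 (lineW L (TW (Fp L) a')) (complexConj_lineW L (TW (Fp L) a')) (lineW_ne_zero L (TW (Fp L) a') (isUnit_det_TW (Fp L) a')) (toHeckeCharacter L lam) (borelPlaceMeasure L) (cmFinLocalFamily L (Equiv.prodUnique (Fin 2) (Fin 1)) dV hdV hdV0 (lineW L (TW (Fp L) a')) (complexConj_lineW L (TW (Fp L) a')) (lineW_ne_zero L (TW (Fp L) a') (isUnit_det_TW (Fp L) a')) (toHeckeCharacter L lam) ((isOscillatorChar_toHeckeCharacter_iff lam).mpr hlam) (borelPlaceMeasure L))) (isSymm_TW (Fp L) a') (JW_eq (Fp L) L a')).s v) ((congrW L (Equiv.prodUnique (Fin 2) (Fin 1)) dV hdV (lineW L (TW (Fp L) a')) (complexConj_lineW L (TW (Fp L) a')) (realDiagonal_lineW L (TW (Fp L) a')) (diagonal_lineW L (TW (Fp L) a') (JW_eq (Fp L) L a')) (undoubledSplittings L (Equiv.prodUnique (Fin 2) (Fin 1)) dV hdV hdV0 (lineW L (TW (Fp L) a')) (complexConj_lineW L (TW (Fp L) a')) (lineW_ne_zero L (TW (Fp L) a')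 (isUnit_det_TW (Fp L) a')) (toHeckeCharacter L lam) (borelPlaceMeasure L) (cmFinLocalFamily L (Equiv.prodUnique (Fin 2) (Fin 1)) dV hdV hdV0 (lineW L (TW (Fp L) a')) (complexConj_lineW L (TW (Fp L) a')) (lineW_ne_zero L (TW (Fp L) a') (isUnit_det_TW (Fp L) a')) (toHeckeCharacter L lam) ((isOscillatorChar_toHeckeCharacter_iff lam).mpr hlam) (borelPlaceMeasure L))) (isSymm_TW (Fp L) a') (JW_eq (Fp L) L a')).proj_s v)))
          (fun g z => (show Commute g (localCenter L (IsCMField.complexConj L) 2 (Matrix.diagonal dV) (JW (Fp L) L a') (JW_apply_ne_zero (Fp L) L a') v z) from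
            localCenter_comm L (IsCMField.complexConj L) 2 (Matrix.diagonal dV) (JW (Fp L) L a') (JW_apply_ne_zero (Fp L) L a') v z g).map ((MpPsi.toRep (localSchrodinger (Fp L) 2 (realDiagonal L dV hdV) v)).comp (lineTransportSection (Fp L) L (IsCMField.complexConj L) 2 (complexConj_imagUnit L) (imagUnit_ne_zero L) (imagUnit_mul_self L) (realDiagonal L dV hdV) (realDiagonal_isSymm L dV hdV) (Matrix.diagonal dV) (realDiagonal_map L dV hdV).symm a' v ((congrW L (Equiv.prodUnique (Fin 2) (Fin 1)) dV hdV (lineW L (TW (Fp L) a')) (complexConj_lineW L (TW (Fp L) a')) (realDiagonal_lineW L (TW (Fp L) a')) (diagonal_lineW L (TW (Fp L) a') (JW_eq (Fp L) L a')) (undoubledSplittings L (Equiv.prodUnique (Fin 2) (Fin 1)) dV hdV hdV0 (lineW L (TW (Fp L) a')) (complexConj_lineW L (TW (Fp L) a')) (lineW_ne_zero L (TW (Fp L) a') (isUnit_det_TW (Fp L) a')) (toHeckeCharacter L lam) (borelPlaceMeasure L) (cmFinLocalFamily L (Equiv.prodUnique (Fin 2) (Fin 1)) dV hdV hdV0 (lineW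 L (TW (Fp L) a')) (complexConj_lineW L (TW (Fp L) a')) (lineW_ne_zero L (TW (Fp L) a') (isUnit_det_TW (Fp L) a')) (toHeckeCharacter L lam) ((isOscillatorChar_toHeckeCharacter_iff lam).mpr hlam) (borelPlaceMeasure L))) (isSymm_TW (Fp L) a') (JW_eq (Fp L) L a')).s v) ((congrW L (Equiv.prodUnique (Fin 2) (Fin 1)) dV hdV (lineW L (TW (Fp L) a')) (complexConj_lineW L (TW (Fp L) a')) (realDiagonal_lineW L (TW (Fp L) a')) (diagonal_lineW L (TW (Fp L) a') (JW_eq (Fp L) L a')) (undoubledSplittings L (Equiv.prodUnique (Fin 2) (Fin 1)) dV hdV hdV0 (lineW L (TW (Fp L) a')) (complexConj_lineW L (TW (Fp L) a')) (lineW_ne_zero L (TW (Fp L) a') (isUnit_det_TW (Fp L) a')) (toHeckeCharacter L lam) (borelPlaceMeasure L) (cmFinLocalFamily L (Equiv.prodUnique (Fin 2) (Fin 1)) dV hdV hdV0 (lineW L (TW (Fp L) a')) (complexConj_lineW L (TW (Fp L) a')) (lineW_ne_zero L (TW (Fp L) a') (isUnit_det_TW (Fp L) a')) (toHeckeCharacter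 L lam) ((isOscillatorChar_toHeckeCharacter_iff lam).mpr hlam) (borelPlaceMeasure L))) (isSymm_TW (Fp L) a') (JW_eq (Fp L) L a')).proj_s v)))))
        (TwistedCoinv.rep
          (ρW := show Representation ℂ (localPi L (IsCMField.complexConj L) 1 (JW (Fp L) L a') v) (SchwartzBruhat (Fin 2 → v.adicCompletion (Fp L))) from
            ((MpPsi.toRep (localSchrodinger (Fp L) 2 (realDiagonal L dV hdV) v)).comp (lineTransportSection (Fp L) L (IsCMField.complexConj L) 2 (complexConj_imagUnit L) (imagUnit_ne_zero L) (imagUnit_mul_self L) (realDiagonal L dV hdV) (realDiagonal_isSymm L dV hdV) (Matrix.diagonal dV) (realDiagonal_map L dV hdV).symm a v ((congrW L (Equiv.prodUnique (Fin 2) (Fin 1)) dV hdV (lineW L (TW (Fp L) a)) (complexConj_lineW L (TW (Fp L) a)) (realDiagonal_lineW L (TW (Fp L) a)) (diagonal_lineW L (TW (Fp L) a) (JW_eq (Fp L) L a)) (undoubledSplittings L (Equiv.prodUnique (Fin 2) (Fin 1)) dV hdV hdV0 (lineW L (TW (Fp L) a)) (complexConj_lineW L (TW (Fp L) a)) (lineW_ne_zero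 L (TW (Fp L) a) (isUnit_det_TW (Fp L) a)) (toHeckeCharacter L lam) (borelPlaceMeasure L) (cmFinLocalFamily L (Equiv.prodUnique (Fin 2) (Fin 1)) dV hdV hdV0 (lineW L (TW (Fp L) a)) (complexConj_lineW L (TW (Fp L) a)) (lineW_ne_zero L (TW (Fp L) a) (isUnit_det_TW (Fp L) a)) (toHeckeCharacter L lam) ((isOscillatorChar_toHeckeCharacter_iff lam).mpr hlam) (borelPlaceMeasure L))) (isSymm_TW (Fp L) a) (JW_eq (Fp L) L a)).s v) ((congrW L (Equiv.prodUnique (Fin 2) (Fin 1)) dV hdV (lineW L (TW (Fp L) a)) (complexConj_lineW L (TW (Fp L) a)) (realDiagonal_lineW L (TW (Fp L) a)) (diagonal_lineW L (TW (Fp L) a) (JW_eq (Fp L) L a)) (undoubledSplittings L (Equiv.prodUnique (Fin 2) (Fin 1)) dV hdV hdV0 (lineW L (TW (Fp L) a)) (complexConj_lineW L (TW (Fp L) a)) (lineW_ne_zero L (TW (Fp L) a) (isUnit_det_TW (Fp L) a)) (toHeckeCharacter L lam) (borelPlaceMeasure L) (cmFinLocalFamily L (Equiv.prodUnique (Fin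 2) (Fin 1)) dV hdV hdV0 (lineW L (TW (Fp L) a)) (complexConj_lineW L (TW (Fp L) a)) (lineW_ne_zero L (TW (Fp L) a) (isUnit_det_TW (Fp L) a)) (toHeckeCharacter L lam) ((isOscillatorChar_toHeckeCharacter_iff lam).mpr hlam) (borelPlaceMeasure L))) (isSymm_TW (Fp L) a) (JW_eq (Fp L) L a)).proj_s v))).comp (localCenter L (IsCMField.complexConj L) 2 (Matrix.diagonal dV) (JW (Fp L) L a') (JW_apply_ne_zero (Fp L) L a') v))
          (localCharOfCenter (Fp L) L (IsCMField.complexConj L) (JW (Fp L) L a') (JW_apply_ne_zero (Fp L) L a') χ.1 v)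
          ((MpPsi.toRep (localSchrodinger (Fp L) 2 (realDiagonal L dV hdV) v)).comp (lineTransportSection (Fp L) L (IsCMField.complexConj L) 2 (complexConj_imagUnit L) (imagUnit_ne_zero L) (imagUnit_mul_self L) (realDiagonal L dV hdV) (realDiagonal_isSymm L dV hdV) (Matrix.diagonal dV) (realDiagonal_map L dV hdV).symm a v ((congrW L (Equiv.prodUnique (Fin 2) (Fin 1)) dV hdV (lineW L (TW (Fp L) a)) (complexConj_lineW L (TW (Fp L) a)) (realDiagonal_lineW L (TW (Fp L) a)) (diagonal_lineW L (TW (Fp L) a) (JW_eq (Fp L) L a)) (undoubledSplittings L (Equiv.prodUnique (Fin 2) (Fin 1)) dV hdV hdV0 (lineW L (TW (Fp L) a)) (complexConj_lineW L (TW (Fp L) a)) (lineW_ne_zero L (TW (Fp L) a) (isUnit_det_TW (Fp L) a)) (toHeckeCharacter L lam) (borelPlaceMeasure L) (cmFinLocalFamily L (Equiv.prodUnique (Fin 2) (Fin 1)) dV hdV hdV0 (lineW L (TW (Fp L) a)) (complexConj_lineW L (TW (Fp L) a)) (lineW_ne_zero L (TW (Fp L) a) (isUnit_det_TW (Fp L)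 a)) (toHeckeCharacter L lam) ((isOscillatorChar_toHeckeCharacter_iff lam).mpr hlam) (borelPlaceMeasure L))) (isSymm_TW (Fp L) a) (JW_eq (Fp L) L a)).s v) ((congrW L (Equiv.prodUnique (Fin 2) (Fin 1)) dV hdV (lineW L (TW (Fp L) a)) (complexConj_lineW L (TW (Fp L) a)) (realDiagonal_lineW L (TW (Fp L) a)) (diagonal_lineW L (TW (Fp L) a) (JW_eq (Fp L) L a)) (undoubledSplittings L (Equiv.prodUnique (Fin 2) (Fin 1)) dV hdV hdV0 (lineW L (TW (Fp L) a)) (complexConj_lineW L (TW (Fp L) a)) (lineW_ne_zero L (TW (Fp L) a) (isUnit_det_TW (Fp L) a)) (toHeckeCharacter L lam) (borelPlaceMeasure L) (cmFinLocalFamily L (Equiv.prodUnique (Fin 2) (Fin 1)) dV hdV hdV0 (lineW L (TW (Fp L) a)) (complexConj_lineW L (TW (Fp L) a)) (lineW_ne_zero L (TW (Fp L) a) (isUnit_det_TW (Fp L) a)) (toHeckeCharacter L lam) ((isOscillatorChar_toHeckeCharacter_iff lam).mpr hlam) (borelPlaceMeasure L))) (isSymm_TW (Fp L) a) (JW_eq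 (Fp L) L a)).proj_s v)))
          (fun g z => (show Commute g (localCenter L (IsCMField.complexConj L) 2 (Matrix.diagonal dV) (JW (Fp L) L a') (JW_apply_ne_zero (Fp L) L a') v z) from
            localCenter_comm L (IsCMField.complexConj L) 2 (Matrix.diagonal dV) (JW (Fp L) L a') (JW_apply_ne_zero (Fp L) L a') v z g).map ((MpPsi.toRep (localSchrodinger (Fp L) 2 (realDiagonal L dV hdV) v)).comp (lineTransportSection (Fp L) L (IsCMField.complexConj L) 2 (complexConj_imagUnit L) (imagUnit_ne_zero L) (imagUnit_mul_self L) (realDiagonal L dV hdV) (realDiagonal_isSymm L dV hdV) (Matrix.diagonal dV) (realDiagonal_map L dV hdV).symm a v ((congrW L (Equiv.prodUnique (Fin 2) (Fin 1)) dV hdV (lineW L (TW (Fp L) a)) (complexConj_lineW L (TW (Fp L) a)) (realDiagonal_lineW L (TW (Fp L) a)) (diagonal_lineW L (TW (Fp L) a) (JW_eq (Fp L) L a)) (undoubledSplittings L (Equiv.prodUnique (Fin 2) (Fin 1)) dV hdV hdV0 (lineW L (TW (Fp L) a)) (complexConj_lineW L (TW (Fp L) a)) (lineW_ne_zero L (TW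 (Fp L) a) (isUnit_det_TW (Fp L) a)) (toHeckeCharacter L lam) (borelPlaceMeasure L) (cmFinLocalFamily L (Equiv.prodUnique (Fin 2) (Fin 1)) dV hdV hdV0 (lineW L (TW (Fp L) a)) (complexConj_lineW L (TW (Fp L) a)) (lineW_ne_zero L (TW (Fp L) a) (isUnit_det_TW (Fp L) a)) (toHeckeCharacter L lam) ((isOscillatorChar_toHeckeCharacter_iff lam).mpr hlam) (borelPlaceMeasure L))) (isSymm_TW (Fp L) a) (JW_eq (Fp L) L a)).s v) ((congrW L (Equiv.prodUnique (Fin 2) (Fin 1)) dV hdV (lineW L (TW (Fp L) a)) (complexConj_lineW L (TW (Fp L) a)) (realDiagonal_lineW L (TW (Fp L) a)) (diagonal_lineW L (TW (Fp L) a) (JW_eq (Fp L) L a)) (undoubledSplittings L (Equiv.prodUnique (Fin 2) (Fin 1)) dV hdV hdV0 (lineW L (TW (Fp L) a)) (complexConj_lineW L (TW (Fp L) a)) (lineW_ne_zero L (TW (Fp L) a) (isUnit_det_TW (Fp L) a)) (toHeckeCharacter L lam) (borelPlaceMeasure L) (cmFinLocalFamily L (Equiv.prodUnique (Fin 2) (Fin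 1)) dV hdV hdV0 (lineW L (TW (Fp L) a)) (complexConj_lineW L (TW (Fp L) a)) (lineW_ne_zero L (TW (Fp L) a) (isUnit_det_TW (Fp L) a)) (toHeckeCharacter L lam) ((isOscillatorChar_toHeckeCharacter_iff lam).mpr hlam) (borelPlaceMeasure L))) (isSymm_TW (Fp L) a) (JW_eq (Fp L) L a)).proj_s v))))) →
      False)
    (hi_a' :
      Nontrivial (TwistedCoinv.Coinv (show Representation ℂ (UnitaryGroup.localPi L (IsCMField.complexConj L) 1 (JW (Fp L) L a') v) (SchwartzBruhat (Fin n' → v.adicCompletion (Fp L))) from (((congrW L e₁ dV hdV (lineW L (TW (Fp L) a')) (complexConj_lineW L (TW (Fp L) a')) (realDiagonal_lineW L (TW (Fp L) a')) (diagonal_lineW L (TW (Fp L) a') (JW_eq (Fp L) L a')) (undoubledSplittings L e₁ dV hdV hdV0 (lineW L (TW (Fp L) a')) (complexConj_lineW L (TW (Fp L) a')) (lineW_ne_zero L (TW (Fp L) a') (isUnit_det_TW (Fp L) a')) (toHeckeCharacter L lam) (borelPlaceMeasure L) (cmFinLocalFamily L e₁ dV hdV hdV0 (lineW L (TW (Fp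 L) a')) (complexConj_lineW L (TW (Fp L) a')) (lineW_ne_zero L (TW (Fp L) a') (isUnit_det_TW (Fp L) a')) (toHeckeCharacter L lam) ((isOscillatorChar_toHeckeCharacter_iff lam).mpr hlam) (borelPlaceMeasure L))) (isSymm_TW (Fp L) a') (JW_eq (Fp L) L a'))).omegaLoc v).comp (localCenter L (IsCMField.complexConj L) n' (Matrix.reindex e₁ e₁ (Matrix.diagonal dV ⊗ₖ JW (Fp L) L a')) (JW (Fp L) L a') (JW_apply_ne_zero (Fp L) L a') v)) (localCharOfCenter (Fp L) L (IsCMField.complexConj L) (JW (Fp L) L a') (JW_apply_ne_zero (Fp L) L a') χ.1 v)))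
    (hiso :
      Nonempty ((show Representation ℂ (localPi L (IsCMField.complexConj L) 2 (Matrix.diagonal dV) v) _ from (TwistedCoinv.rep (localCharOfCenter (Fp L) L (IsCMField.complexConj L) (JW (Fp L) L a) (JW_apply_ne_zero (Fp L) L a) χ.1 v) (((congrW L e₁ dV hdV (lineW L (TW (Fp L) a)) (complexConj_lineW L (TW (Fp L) a)) (realDiagonal_lineW L (TW (Fp L) a)) (diagonal_lineW L (TW (Fp L) a) (JW_eq (Fp L) L a)) (undoubledSplittings L e₁ dV hdV hdV0 (lineW L (TW (Fp L) a)) (complexConj_lineW L (TW (Fp L) a)) (lineW_ne_zero L (TW (Fp L) a) (isUnit_det_TW (Fp L) a)) (toHeckeCharacter L lam) (borelPlaceMeasure L) (cmFinLocalFamily L e₁ dV hdV hdV0 (lineW L (TW (Fp L) a)) (complexConj_lineW L (TW (Fp L) a)) (lineW_ne_zero L (TW (Fp L) a) (isUnit_det_TW (Fp L) a)) (toHeckeCharacter L lam) ((isOscillatorChar_toHeckeCharacter_iff lam).mpr hlam) (borelPlaceMeasure L))) (isSymm_TW (Fp L) a) (JW_eq (Fp L) L a))).omegaLoc v) (commute_omegaLoc_localCenter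 (Fp L) L (IsCMField.complexConj L) 2 e₁ (Matrix.diagonal dV) (JW (Fp L) L a) (complexConj_imagUnit L) (imagUnit_ne_zero L) (imagUnit_mul_self L) (realDiagonal_isSymm L dV hdV) (isSymm_TW (Fp L) a) (realDiagonal_map L dV hdV).symm (JW_eq (Fp L) L a) (JW_apply_ne_zero (Fp L) L a) (congrW L e₁ dV hdV (lineW L (TW (Fp L) a)) (complexConj_lineW L (TW (Fp L) a)) (realDiagonal_lineW L (TW (Fp L) a)) (diagonal_lineW L (TW (Fp L) a) (JW_eq (Fp L) L a)) (undoubledSplittings L e₁ dV hdV hdV0 (lineW L (TW (Fp L) a)) (complexConj_lineW L (TW (Fp L) a)) (lineW_ne_zero L (TW (Fp L) a) (isUnit_det_TW (Fp L) a)) (toHeckeCharacter L lam) (borelPlaceMeasure L) (cmFinLocalFamily L e₁ dV hdV hdV0 (lineW L (TW (Fp L) a)) (complexConj_lineW L (TW (Fp L) a)) (lineW_ne_zero L (TW (Fp L) a) (isUnit_det_TW (Fp L) a)) (toHeckeCharacter L lam) ((isOscillatorChar_toHeckeCharacter_iff lam).mpr hlam) (borelPlaceMeasure L))) (isSymm_TW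 (Fp L) a) (JW_eq (Fp L) L a)) v)).comp (localLineInl L (IsCMField.complexConj L) 2 e₁ (Matrix.diagonal dV) (JW (Fp L) L a) v)).Equiv
        (show Representation ℂ (localPi L (IsCMField.complexConj L) 2 (Matrix.diagonal dV) v) _ from (TwistedCoinv.rep (localCharOfCenter (Fp L) L (IsCMField.complexConj L) (JW (Fp L) L a') (JW_apply_ne_zero (Fp L) L a') χ.1 v) (((congrW L e₁ dV hdV (lineW L (TW (Fp L) a')) (complexConj_lineW L (TW (Fp L) a')) (realDiagonal_lineW L (TW (Fp L) a')) (diagonal_lineW L (TW (Fp L) a') (JW_eq (Fp L) L a')) (undoubledSplittings L e₁ dV hdV hdV0 (lineW L (TW (Fp L) a')) (complexConj_lineW L (TW (Fp L) a')) (lineW_ne_zero L (TW (Fp L) a') (isUnit_det_TW (Fp L) a')) (toHeckeCharacter L lam) (borelPlaceMeasure L) (cmFinLocalFamily L e₁ dV hdV hdV0 (lineW L (TW (Fp L) a')) (complexConj_lineW L (TW (Fp L) a')) (lineW_ne_zero L (TW (Fp L) a') (isUnit_det_TW (Fp L) a')) (toHeckeCharacter L lam) ((isOscillatorChar_toHeckeCharacter_iff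 lam).mpr hlam) (borelPlaceMeasure L))) (isSymm_TW (Fp L) a') (JW_eq (Fp L) L a'))).omegaLoc v) (commute_omegaLoc_localCenter (Fp L) L (IsCMField.complexConj L) 2 e₁ (Matrix.diagonal dV) (JW (Fp L) L a') (complexConj_imagUnit L) (imagUnit_ne_zero L) (imagUnit_mul_self L) (realDiagonal_isSymm L dV hdV) (isSymm_TW (Fp L) a') (realDiagonal_map L dV hdV).symm (JW_eq (Fp L) L a') (JW_apply_ne_zero (Fp L) L a') (congrW L e₁ dV hdV (lineW L (TW (Fp L) a')) (complexConj_lineW L (TW (Fp L) a')) (realDiagonal_lineW L (TW (Fp L) a')) (diagonal_lineW L (TW (Fp L) a') (JW_eq (Fp L) L a')) (undoubledSplittings L e₁ dV hdV hdV0 (lineW L (TW (Fp L) a')) (complexConj_lineW L (TW (Fp L) a')) (lineW_ne_zero L (TW (Fp L) a') (isUnit_det_TW (Fp L) a')) (toHeckeCharacter L lam) (borelPlaceMeasure L) (cmFinLocalFamily L e₁ dV hdV hdV0 (lineW L (TW (Fp L) a')) (complexConj_lineW L (TW (Fp L) a')) (lineW_ne_zero L (TW (Fp L) a') (isUnit_det_TW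 (Fp L) a')) (toHeckeCharacter L lam) ((isOscillatorChar_toHeckeCharacter_iff lam).mpr hlam) (borelPlaceMeasure L))) (isSymm_TW (Fp L) a') (JW_eq (Fp L) L a')) v)).comp (localLineInl L (IsCMField.complexConj L) 2 e₁ (Matrix.diagonal dV) (JW (Fp L) L a') v)))) :
    locF (↥(maximalRealSubfield L)) (imagUnitSq L) a v = locF (↥(maximalRealSubfield L)) (imagUnitSq L) a' v := by
  -- `n′ = 2` (so that `e₁` and `Equiv.prodUnique (Fin 2) (Fin 1)` are enumerations of the same `Fin 2`)
  have hn' : n' = 2 := by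
    have h := Fintype.card_congr e₁
    simp only [Fintype.card_prod, Fintype.card_fin, mul_one] at h
    omega
  subst hn'
  -- ★ (E): the enumeration `e₁` ↦ `Equiv.prodUnique (Fin 2) (Fin 1)` on both packages
  have ha := areIsomorphicRep_theta_cmPackage_of_equiv L v dV hdV hdV0 (Equiv.prodUnique (Fin 2) (Fin 1)) e₁ (toHeckeCharacter L lam)
    ((isOscillatorChar_toHeckeCharacter_iff lam).mpr hlam) a
    (localCharOfCenter (Fp L) L (IsCMField.complexConj L) (JW (Fp L) L a) (JW_apply_ne_zero (Fp L) L a) χ.1 v)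
  have ha' := areIsomorphicRep_theta_cmPackage_of_equiv L v dV hdV hdV0 e₁ (Equiv.prodUnique (Fin 2) (Fin 1)) (toHeckeCharacter L lam)
    ((isOscillatorChar_toHeckeCharacter_iff lam).mpr hlam) a'
    (localCharOfCenter (Fp L) L (IsCMField.complexConj L) (JW (Fp L) L a') (JW_apply_ne_zero (Fp L) L a') χ.1 v)
  -- `Θ_{pU}(a′) ≅ Θ_{pU}(a)` (R₂'s isomorphism reversed)
  have hisoPU := ((ha.trans (hiso.elim fun E => areIsomorphicRep_of_equiv E)).trans ha').symm
  -- `Θ_{pU}(a′) ≠ 0`: R₂'s non-vanishing carried `e₁ ↦ pU` along ★ (E)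
  have hntPU : Nontrivial (TwistedCoinv.Coinv
      (show Representation ℂ (UnitaryGroup.localPi L (IsCMField.complexConj L) 1 (JW (Fp L) L a') v) (SchwartzBruhat (Fin 2 → v.adicCompletion (Fp L))) from
        ((congrW L (Equiv.prodUnique (Fin 2) (Fin 1)) dV hdV (lineW L (TW (Fp L) a')) (complexConj_lineW L (TW (Fp L) a')) (realDiagonal_lineW L (TW (Fp L) a')) (diagonal_lineW L (TW (Fp L) a') (JW_eq (Fp L) L a')) (undoubledSplittings L (Equiv.prodUnique (Fin 2) (Fin 1)) dV hdV hdV0 (lineW L (TW (Fp L) a')) (complexConj_lineW L (TW (Fp L) a')) (lineW_ne_zero L (TW (Fp L) a') (isUnit_det_TW (Fp L) a')) (toHeckeCharacter L lam) (borelPlaceMeasure L) (cmFinLocalFamily L (Equiv.prodUnique (Fin 2) (Fin 1)) dV hdV hdV0 (lineW L (TW (Fp L) a')) (complexConj_lineW L (TW (Fp L) a')) (lineW_ne_zero L (TW (Fp L) a') (isUnit_det_TW (Fp L) a')) (toHeckeCharacter L lam) ((isOscillatorChar_toHeckeCharacter_iff lam).mpr hlam) (borelPlaceMeasure L))) (isSymm_TW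 (Fp L) a') (JW_eq (Fp L) L a')).omegaLoc v).comp (localCenter L (IsCMField.complexConj L) 2 (Matrix.reindex (Equiv.prodUnique (Fin 2) (Fin 1)) (Equiv.prodUnique (Fin 2) (Fin 1)) ((Matrix.diagonal dV) ⊗ₖ JW (Fp L) L a')) (JW (Fp L) L a') (JW_apply_ne_zero (Fp L) L a') v))
      (localCharOfCenter (Fp L) L (IsCMField.complexConj L) (JW (Fp L) L a') (JW_apply_ne_zero (Fp L) L a') χ.1 v)) := by
    obtain ⟨f, -⟩ := ha'
    haveI := hi_a'
    exact f.symm.toEquiv.nontrivial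
  -- the road-agnostic `(ε, χ)`-clauses on the family `0 ↦ a`, `1 ↦ a′` at `Equiv.prodUnique`, `j := 1`, `i := 0`
  have key := sameClass_and_chi_eq_of_areIsomorphicRep_localType₂_nonsplit_of_separation (Fp L) L (IsCMField.complexConj L) 2
    (Matrix.diagonal dV) (complexConj_imagUnit L) (imagUnit_ne_zero L) (imagUnit_mul_self L) (realDiagonal_isSymm L dV hdV)
    (isUnit_det_realDiagonal L dV hdV hdV0) (realDiagonal_map L dV hdV).symm le_rfl ![a, a'] (fun _ => χ)
    (Fin.cons (α := fun i : Fin 2 => LocalSplitting.FinLocalSplittings (Fp L) L (IsCMField.complexConj L) 2 (complexConj_imagUnit L)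
      (imagUnit_ne_zero L) (imagUnit_mul_self L) (gram (Fp L) (Equiv.prodUnique (Fin 2) (Fin 1)) (realDiagonal L dV hdV) (TW (Fp L) (![a, a'] i)))
      (isSymm_gram (Fp L) (Equiv.prodUnique (Fin 2) (Fin 1)) (realDiagonal_isSymm L dV hdV) (isSymm_TW (Fp L) (![a, a'] i)))
      (reindex_kronecker_eq_gram_map (Fp L) L (Equiv.prodUnique (Fin 2) (Fin 1)) (realDiagonal_map L dV hdV).symm (JW_eq (Fp L) L (![a, a'] i))))
      (congrW L (Equiv.prodUnique (Fin 2) (Fin 1)) dV hdV (lineW L (TW (Fp L) a)) (complexConj_lineW L (TW (Fp L) a)) (realDiagonal_lineW L (TW (Fp L) a)) (diagonal_lineW L (TW (Fp L) a) (JW_eq (Fp L) L a)) (undoubledSplittings L (Equiv.prodUnique (Fin 2) (Fin 1)) dV hdV hdV0 (lineW L (TW (Fp L) a)) (complexConj_lineW L (TW (Fp L) a)) (lineW_ne_zero L (TW (Fp L) a) (isUnit_det_TW (Fp L) a)) (toHeckeCharacter L lam) (borelPlaceMeasure L) (cmFinLocalFamily L (Equiv.prodUnique (Fin 2) (Fin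 1)) dV hdV hdV0 (lineW L (TW (Fp L) a)) (complexConj_lineW L (TW (Fp L) a)) (lineW_ne_zero L (TW (Fp L) a) (isUnit_det_TW (Fp L) a)) (toHeckeCharacter L lam) ((isOscillatorChar_toHeckeCharacter_iff lam).mpr hlam) (borelPlaceMeasure L))) (isSymm_TW (Fp L) a) (JW_eq (Fp L) L a)) (Fin.cons (congrW L (Equiv.prodUnique (Fin 2) (Fin 1)) dV hdV (lineW L (TW (Fp L) a')) (complexConj_lineW L (TW (Fp L) a')) (realDiagonal_lineW L (TW (Fp L) a')) (diagonal_lineW L (TW (Fp L) a') (JW_eq (Fp L) L a')) (undoubledSplittings L (Equiv.prodUnique (Fin 2) (Fin 1)) dV hdV hdV0 (lineW L (TW (Fp L) a')) (complexConj_lineW L (TW (Fp L) a')) (lineW_ne_zero L (TW (Fp L) a') (isUnit_det_TW (Fp L) a')) (toHeckeCharacter L lam) (borelPlaceMeasure L) (cmFinLocalFamily L (Equiv.prodUnique (Fin 2) (Fin 1)) dV hdV hdV0 (lineW L (TW (Fp L) a')) (complexConj_lineW L (TW (Fp L) a')) (lineW_ne_zero L (TW (Fp L) a') (isUnit_det_TW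 (Fp L) a')) (toHeckeCharacter L lam) ((isOscillatorChar_toHeckeCharacter_iff lam).mpr hlam) (borelPlaceMeasure L))) (isSymm_TW (Fp L) a') (JW_eq (Fp L) L a')) finZeroElim))
    (fun _ => localMu L (toHeckeCharacter L lam)) (fun _ v x => norm_localMu L (toHeckeCharacter L lam) v (isUnitary_toHeckeCharacter L lam) x)
    (fun _ => continuous_localMu L (toHeckeCharacter L lam))
    (fun _ v t => localMu_toLocalRing_eq_one_iff L (toHeckeCharacter L lam) v ((isOscillatorChar_toHeckeCharacter_iff lam).mpr hlam) t)
    v 0 1 hsep hntPU hisoPU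
  -- same class of the Step-1 representatives `(aδ) ⊗ 1 ~ (a′δ) ⊗ 1` ⟹ same local norm class
  exact locF_apply_eq_of_sameClass_epsLine (Fp L) L (IsCMField.complexConj L) 2 (Matrix.diagonal dV) (complexConj_imagUnit L) (imagUnit_ne_zero L)
    (imagUnit_mul_self L) le_rfl _ _ v a a' key.1

end Summit.HodgeConjecture.HodgeConjecture.Cruxes.HLiu418.F0LD1SameLabelRigidityOfSeparation

end
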